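import Literature.NumberTheory.PAdicHodge.KatoH1BdRFilHolds
import Literature.NumberTheory.PAdicHodge.PadicFieldOneUnits
import HarnessLib

/-!
# Lifting `ℂ_F`-periods of `F`-valued characters to unit periods in `B_dR⁺`

Let `F/ℚ_p` be a non-archimedean local field of characteristic zero, `ℂ_F` the completed algebraic
closure, `B_dR⁺ = B_dR⁺(𝒪_{ℂ_F})` with `θ : B_dR⁺ → ℂ_F`, `t = log[ε]`, and `F ↪ B_dR⁺` the canonical
embedding `embBdRHom` (a section of `θ` over `F`, fixed by `Γ_F`).

**Theorem** (`exists_galBdRPlus_eq_embBdRHom_mul`). Let `η : Γ_F → Fˣ` be a continuous character and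
`u ∈ ℂ_F`, `u ≠ 0`, a period of `η` in `ℂ_F`, i.e. `σ(u) = η(σ) · u` for all `σ ∈ Γ_F`. Then `u` lifts to a
period in `B_dR⁺`: there is `b ∈ B_dR⁺` with `θ(b) = u` (so `b` is a unit) and `σ(b) = η(σ) · b` for all `σ`.

In other words: a rank-one `F`-linear representation of `Γ_F` which is `ℂ_F`-admissible is
`B_dR⁺`-admissible with a *unit* period (Hodge–Tate weight `0` at the identity label lifts to de Rham).
This is the input that turns Lubin–Tate / Tate–Sen `ℂ_F`-periods of conjugates of Lubin–Tate characters
into de Rham periods.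

**Proof** (Fontaine's `t`-adic successive approximation, [cite: FontaineAsterisque223III, Exp. II §1.5.5]
with Tate's vanishing `H¹_cont(Γ_F, ℂ_F(χ^j)) = 0`, `j ≠ 0` [cite: Tate1967, §3.3 Theorem 2], and the
Tate–Sen axiom (TS1) for `ℂ_F` [cite: Sen1980, §1]). Start with any lift `b₁` of `u`; the error cochain
`σ ↦ σ(b₁) − η(σ) b₁` has `θ = 0`, so it is `t · z₁(σ)`. Inductively, if `σ(b) − η(σ) b = t^{n+1} z(σ)` then
`θ(z(σ)) · σ(u)⁻¹` is a continuous `1`-cocycle of `Γ_F` in `ℂ_F(χ^{n+1})`, hence a coboundary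
`χ^{n+1}(σ) σ(B₀) − B₀`; correcting `b` by `t^{n+1} b₀` with `θ(b₀) = B₀ u` makes the error divisible by
`t^{n+2}`. Continuity of the cochains along the iteration is tracked with the uniform-continuity predicate
of `GaloisContinuity` (`Λ(N,k) = p^N 𝔸_inf + ξ^k B_dR⁺`), exactly as in the dévissage for
`H¹(Γ_F, B_dR⁺)` (`BdRTateGraded`, `BdRH1Devissage`). The corrections converge for the `ker θ`-adic topology
(`B_dR⁺` is `ξ`-adically complete) and the limit is the sought period; equivariance of the limit holds
modulo every power of `ξ` and `B_dR⁺` is `ξ`-adically Hausdorff.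

Context: [cite: SerreAbelianLadic1968, Ch. III §A.5] (locally algebraic abelian representations are
Hodge–Tate; with Fontaine's `B_dR` they are de Rham).
-/

noncomputable section

open ValuativeRel Field Ideal WittVector Topology Filter

namespace Literature.NumberTheory.PAdicHodge

open Literature.NumberTheory.GaloisRepresentations
open Literature.NumberTheory.GaloisRepresentations.IsNonarchimedeanLocalField

namespace BdRUnitPeriodLift

variable {F : Type} [Field F] [ValuativeRel F] [TopologicalSpace F] [IsNonarchimedeanLocalField F]
  [CharZero F] {p : ℕ} [Fact p.Prime] [Fact (¬ IsUnit (p : integerC F))]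
  [IsAdicComplete (Ideal.span {(p : integerC F)}) (integerC F)]
  (hp : valuation F p < 1) (hF : Function.Surjective (fontaineTheta (integerC F) p))

/-! ## §1 Elementary identities in `B_dR⁺` -/

/-- `σ(t^m) = χ(σ)^m · t^m`. [cite: FontaineAsterisque223III, Exp. II §1.5.4] -/
theorem galBdRPlus_tBdR_pow (σ : absoluteGaloisGroup F) (m : ℕ) :
    galBdRPlus σ ((tBdR : BDeRhamPlus (integerC F) p) ^ m) =
      (qpToBdR (((GaloisRep.cyclotomicCharacter F p σ : ℤ_[p]ˣ) : ℤ_[p]) : ℚ_[p])) ^ m * tBdR ^ m := by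
  rw [map_pow, galBdRPlus_tBdR, mul_pow]

omit [CharZero F] in
/-- `ι_{ℚ_p}(χ(σ)^{(m : ℤ)}) = ι_{ℚ_p}(χ(σ))^m` in `B_dR⁺`. [folklore] -/
private theorem qpToBdR_cyclotomic_zpow_natCast (σ : absoluteGaloisGroup F) (m : ℕ) :
    (qpToBdR (((GaloisRep.cyclotomicCharacter F p σ ^ (m : ℤ) : ℤ_[p]ˣ) : ℤ_[p]) : ℚ_[p]) :
        BDeRhamPlus (integerC F) p) =
      (qpToBdR (((GaloisRep.cyclotomicCharacter F p σ : ℤ_[p]ˣ) : ℤ_[p]) : ℚ_[p])) ^ m := by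
  rw [zpow_natCast, Units.val_pow_eq_pow_val, PadicInt.coe_pow, map_pow]

include hF in
/-- An element of `ker θ` is a multiple of `t` (`ker θ = (ξ) = (t)`).
[cite: FontaineAsterisque223III, Exp. II §1.5.5] -/
theorem exists_eq_tBdR_mul_of_thetaBdR_eq_zero {x : BDeRhamPlus (integerC F) p} (hx : thetaBdR x = 0) :
    ∃ y : BDeRhamPlus (integerC F) p, x = tBdR * y := by
  obtain ⟨v, hv, htv⟩ := exists_tBdR_eq_xiBdR_mul (F := F) (p := p) hF
  obtain ⟨c, hc⟩ := Ideal.mem_span_singleton'.1 ((mem_ker_thetaBdR_iff _).1 hx)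
  refine ⟨((hv.unit⁻¹ : (BDeRhamPlus (integerC F) p)ˣ) : BDeRhamPlus (integerC F) p) * c, ?_⟩
  rw [← hc, htv, mul_comm c xiBdR, mul_assoc, ← mul_assoc v, IsUnit.mul_val_inv, one_mul]

/-- `t^m · y ∈ (ξ)^m`. [cite: FontaineAsterisque223III, Exp. II §1.5.5] -/
theorem tBdR_pow_mul_mem_span_xiBdR_pow (hF : Function.Surjective (fontaineTheta (integerC F) p))
    (m : ℕ) (y : BDeRhamPlus (integerC F) p) :
    tBdR ^ m * y ∈ (Ideal.span {(xiBdR : BDeRhamPlus (integerC F) p)}) ^ m := by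
  obtain ⟨v, -, htv⟩ := exists_tBdR_eq_xiBdR_mul (F := F) (p := p) hF
  rw [Ideal.span_singleton_pow, Ideal.mem_span_singleton, htv, mul_pow, mul_assoc]
  exact dvd_mul_right _ _

/-! ## §2 Scalar cochains `σ ↦ ι(f σ) · b` with `f : Γ_F → F` continuous are continuous -/

/-- **`σ ↦ ι_F(f(σ)) · b` is a continuous cochain** for `f : Γ_F → F` continuous and `b ∈ B_dR⁺`
(expand `f` in a `ℚ_p`-basis of `F`; each coordinate is a continuous `ℚ_p`-valued function, and
`ι_{ℚ_p}(c) · b'` is continuous because every element of `B_dR⁺` is bounded).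
[cite: FontaineAsterisque223III, Exp. II §1.5.3] [cite: Kato1993LNM1553, Ch. II §1.2.5] -/
theorem uc_embBdRHom_mul {f : absoluteGaloisGroup F → F} (hf : Continuous f)
    (b : BDeRhamPlus (integerC F) p) :
    ∀ N k : ℕ, ∃ U : OpenSubgroup (absoluteGaloisGroup F), ∀ σ : absoluteGaloisGroup F, ∀ τ ∈ U,
      ∃ (a : Ainf (p := p) F) (w : BDeRhamPlus (integerC F) p),
        embBdRHom hp hF (f (σ * τ)) * b - embBdRHom hp hF (f σ) * b =
          ainfToBdR ((p : Ainf (p := p) F) ^ N * a) + xiBdR ^ k * w := by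
  classical
  letI := LocalField.padicAlgebra F p hp
  haveI := PadicField.finiteDimensional F p hp
  let bF := Module.finBasis ℚ_[p] F
  have hexp : ∀ σ, embBdRHom hp hF (f σ) * b =
      ∑ i, qpToBdR (bF.repr (f σ) i) * (embBdRHom hp hF (bF i) * b) := by
    intro σ
    conv_lhs => rw [← bF.sum_repr (f σ)]
    rw [map_sum, Finset.sum_mul]
    refine Finset.sum_congr rfl fun i _ => ?_
    rw [Algebra.smul_def, map_mul, BdRH1Devissage.embBdRHom_algebraMap_padic hp hF, mul_assoc]
  have hcoord : ∀ i, Continuous fun σ => bF.repr (f σ) i := fun i => by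
    have h := (PadicField.continuous_linearMap hp (bF.coord i)).comp hf
    simpa [Function.comp_def, Module.Basis.coord_apply] using h
  have h := GaloisContinuity.uc_sum (p := p) (F := F) Finset.univ
    (z := fun i σ => qpToBdR (bF.repr (f σ) i) * (embBdRHom hp hF (bF i) * b))
    (fun i _ => GaloisContinuity.uc_qpToBdR_mul (y := fun _ => embBdRHom hp hF (bF i) * b)
      (hcoord i) (GaloisContinuity.uc_const _) fun k => by
        obtain ⟨r, a, w, h⟩ := GaloisContinuity.exists_natCast_pow_mul_eq_ainfToBdR_add
          (embBdRHom hp hF (bF i) * b) k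
        exact ⟨r, fun _ => ⟨a, w, h⟩⟩)
  intro N k
  obtain ⟨U, hU⟩ := h N k
  refine ⟨U, fun σ τ hτ => ?_⟩
  rw [hexp, hexp]
  exact hU σ τ hτ

/-! ## §3 The approximation step -/

set_option maxHeartbeats 1600000 in
/-- **The step.** If `θ(b) = u` and `σ(b) − η(σ) b = t^{n+1} z(σ)` with `z` continuous, then for a suitable
`y ∈ B_dR⁺` and a continuous `z'`, `σ(b − t^{n+1} y) − η(σ)(b − t^{n+1} y) = t^{n+2} z'(σ)`.
The obstruction `σ ↦ θ(z σ) · σ(u)⁻¹` is a continuous cocycle in `ℂ_F(χ^{n+1})`, killed by Tate.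
[cite: Tate1967, §3.3 Theorem 2] [cite: FontaineAsterisque223III, Exp. II §1.5.5] [cite: Sen1980, §1] -/
theorem step (η : absoluteGaloisGroup F →ₜ* Fˣ) {u w : CompletedAlgClosure F} (huw : u * w = 1)
    (hper : ∀ σ : absoluteGaloisGroup F,
      σ • u = algebraMap F (CompletedAlgClosure F) ((η σ : Fˣ) : F) * u)
    (n : ℕ) (b : BDeRhamPlus (integerC F) p)
    (z : absoluteGaloisGroup F → BDeRhamPlus (integerC F) p)
    (hzuc : ∀ N k : ℕ, ∃ U : OpenSubgroup (absoluteGaloisGroup F), ∀ σ : absoluteGaloisGroup F, ∀ τ ∈ U,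
      ∃ (a : Ainf (p := p) F) (w : BDeRhamPlus (integerC F) p),
        z (σ * τ) - z σ = ainfToBdR ((p : Ainf (p := p) F) ^ N * a) + xiBdR ^ k * w)
    (hz : ∀ σ, galBdRPlus σ b - embBdRHom hp hF ((η σ : Fˣ) : F) * b = tBdR ^ (n + 1) * z σ) :
    ∃ (y : BDeRhamPlus (integerC F) p) (z' : absoluteGaloisGroup F → BDeRhamPlus (integerC F) p),
      (∀ N k : ℕ, ∃ U : OpenSubgroup (absoluteGaloisGroup F), ∀ σ : absoluteGaloisGroup F, ∀ τ ∈ U,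
        ∃ (a : Ainf (p := p) F) (w : BDeRhamPlus (integerC F) p),
          z' (σ * τ) - z' σ = ainfToBdR ((p : Ainf (p := p) F) ^ N * a) + xiBdR ^ k * w) ∧
      ∀ σ, galBdRPlus σ (b - tBdR ^ (n + 1) * y) -
          embBdRHom hp hF ((η σ : Fˣ) : F) * (b - tBdR ^ (n + 1) * y) = tBdR ^ (n + 2) * z' σ := by
  classical
  haveI := isDomain_bDeRhamPlus (F := F) (p := p) hF
  -- the characters, in `B_dR⁺` and in `ℂ_F`
  have hηmul : ∀ σ τ : absoluteGaloisGroup F, embBdRHom hp hF ((η (σ * τ) : Fˣ) : F) =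
      embBdRHom hp hF ((η σ : Fˣ) : F) * embBdRHom hp hF ((η τ : Fˣ) : F) := by
    intro σ τ; rw [map_mul, Units.val_mul, map_mul]
  have hθχ : ∀ σ : absoluteGaloisGroup F,
      thetaBdR (qpToBdR (((GaloisRep.cyclotomicCharacter F p σ : ℤ_[p]ˣ) : ℤ_[p]) : ℚ_[p]) :
        BDeRhamPlus (integerC F) p) = algebraMap F (CompletedAlgClosure F)
          (LocalField.padicRingHom F p hp (((GaloisRep.cyclotomicCharacter F p σ : ℤ_[p]ˣ) : ℤ_[p]) :
            ℚ_[p])) := fun σ => by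
    rw [← BdRH1Devissage.embBdRHom_padicRingHom hp hF, thetaBdR_embBdRHom]
  have ht0 : (tBdR : BDeRhamPlus (integerC F) p) ≠ 0 := tBdR_ne_zero hF
  have hgal : ∀ σ, galBdRPlus σ b = embBdRHom hp hF ((η σ : Fˣ) : F) * b + tBdR ^ (n + 1) * z σ :=
    fun σ => by rw [← hz σ]; ring
  -- (a) the cocycle relation of `z`
  have hzcoc : ∀ σ τ, z (σ * τ) = embBdRHom hp hF ((η τ : Fˣ) : F) * z σ +
      (qpToBdR (((GaloisRep.cyclotomicCharacter F p σ : ℤ_[p]ˣ) : ℤ_[p]) : ℚ_[p])) ^ (n + 1) *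
        galBdRPlus σ (z τ) := by
    intro σ τ
    apply mul_left_cancel₀ (pow_ne_zero (n + 1) ht0)
    rw [← hz (σ * τ), galBdRPlus_mul, hgal τ, map_add, map_mul, map_mul, galBdRPlus_embBdRHom,
      galBdRPlus_tBdR_pow, hgal σ, hηmul]
    ring
  -- (b) facts about `u`, `w = u⁻¹`
  have hu0 : u ≠ 0 := fun h => by rw [h, zero_mul] at huw; exact zero_ne_one huw
  have hw0 : w ≠ 0 := fun h => by rw [h, mul_zero] at huw; exact zero_ne_one huw
  have hη0 : ∀ σ, algebraMap F (CompletedAlgClosure F) ((η σ : Fˣ) : F) ≠ 0 := fun σ =>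
    (map_ne_zero _).2 (Units.ne_zero _)
  have hσw : ∀ σ : absoluteGaloisGroup F,
      σ • w = (algebraMap F (CompletedAlgClosure F) ((η σ : Fˣ) : F))⁻¹ * w := by
    intro σ
    have h1 : σ • u * σ • w = 1 := by rw [← smul_mul', huw, smul_one]
    rw [hper] at h1
    calc σ • w = (algebraMap F (CompletedAlgClosure F) ((η σ : Fˣ) : F) * u)⁻¹ :=
          eq_inv_of_mul_eq_one_right h1
      _ = _ := by rw [mul_inv, ← eq_inv_of_mul_eq_one_right huw]
  have hsw0 : ∀ σ : absoluteGaloisGroup F, σ • w ≠ 0 := fun σ => by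
    rw [hσw]; exact mul_ne_zero (inv_ne_zero (hη0 σ)) hw0
  -- (c) the `χ^{n+1}`-twisted continuous cocycle `k(σ) = θ(z σ) · σ(w)`
  have hN : ((n : ℤ) + 1) ≠ 0 := by omega
  have hpow : ∀ x : CompletedAlgClosure F, x ^ ((n : ℤ) + 1) = x ^ (n + 1) := fun x => by
    rw [show ((n : ℤ) + 1) = ((n + 1 : ℕ) : ℤ) by push_cast; ring, zpow_natCast]
  have hkcoc : ∀ σ τ : absoluteGaloisGroup F,
      thetaBdR (z (σ * τ)) * (σ * τ) • w = thetaBdR (z σ) * σ • w +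
        (algebraMap F (CompletedAlgClosure F) (LocalField.padicRingHom F p hp
          (((GaloisRep.cyclotomicCharacter F p σ : ℤ_[p]ˣ) : ℤ_[p]) : ℚ_[p]))) ^ ((n : ℤ) + 1) *
          (σ • (thetaBdR (z τ) * τ • w)) := by
    intro σ τ
    rw [hpow, hzcoc, map_add, map_mul, map_mul, map_pow, thetaBdR_embBdRHom, hθχ,
      thetaBdR_galBdRPlus, mul_smul, hσw τ]
    simp only [smul_mul', smul_inv'', CompletedAlgClosure.smul_algebraMap]
    have hA : algebraMap F (CompletedAlgClosure F) ((η τ : Fˣ) : F) *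
        (algebraMap F (CompletedAlgClosure F) ((η τ : Fˣ) : F))⁻¹ = 1 := mul_inv_cancel₀ (hη0 τ)
    linear_combination (thetaBdR (z σ) * σ • w) * hA
  have hkcont : Continuous fun σ : absoluteGaloisGroup F => thetaBdR (z σ) * σ • w :=
    (GaloisContinuity.continuous_thetaBdR_of_uc hp hzuc).mul (TateSen.continuous_smul_left w)
  -- (d) Tate: `k` is a coboundary
  obtain ⟨B₀, hB₀⟩ := TateTwisted.absGalois_exists_eq_twistedCoboundary hp
    tate1967_TS1_completedAlgClosure_holds hN hkcoc hkcont
  -- (e) the correction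
  obtain ⟨b₀, hb₀⟩ := thetaBdR_surjective hF (B₀ * u)
  have hηcont : Continuous fun σ : absoluteGaloisGroup F => ((η σ : Fˣ) : F) :=
    Units.continuous_val.comp η.continuous
  -- the corrected error cochain `zt`
  have hθzt : ∀ σ : absoluteGaloisGroup F, thetaBdR (z σ -
      ((qpToBdR (((GaloisRep.cyclotomicCharacter F p σ : ℤ_[p]ˣ) : ℤ_[p]) : ℚ_[p])) ^ (n + 1) *
          galBdRPlus σ b₀ - b₀) + (embBdRHom hp hF ((η σ : Fˣ) : F) * b₀ - b₀)) = 0 := by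
    intro σ
    have e2 := hB₀ σ
    rw [hpow, hσw σ] at e2
    have hainv : algebraMap F (CompletedAlgClosure F) ((η σ : Fˣ) : F) *
        (algebraMap F (CompletedAlgClosure F) ((η σ : Fˣ) : F))⁻¹ = 1 := mul_inv_cancel₀ (hη0 σ)
    have key : thetaBdR (z σ -
      ((qpToBdR (((GaloisRep.cyclotomicCharacter F p σ : ℤ_[p]ˣ) : ℤ_[p]) : ℚ_[p])) ^ (n + 1) *
          galBdRPlus σ b₀ - b₀) + (embBdRHom hp hF ((η σ : Fˣ) : F) * b₀ - b₀)) * σ • w = 0 := by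
      rw [map_add, map_sub, map_sub, map_sub, map_mul, map_mul, map_pow, hθχ, thetaBdR_embBdRHom,
        thetaBdR_galBdRPlus, hb₀, smul_mul', hper σ, hσw σ]
      linear_combination e2 -
        ((algebraMap F (CompletedAlgClosure F) (LocalField.padicRingHom F p hp
          (((GaloisRep.cyclotomicCharacter F p σ : ℤ_[p]ˣ) : ℤ_[p]) : ℚ_[p]))) ^ (n + 1) * σ • B₀ - B₀) *
          (u * w) * hainv -
        ((algebraMap F (CompletedAlgClosure F) (LocalField.padicRingHom F p hp
          (((GaloisRep.cyclotomicCharacter F p σ : ℤ_[p]ˣ) : ℤ_[p]) : ℚ_[p]))) ^ (n + 1) * σ • B₀ - B₀) *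
          huw
    exact (mul_eq_zero.1 key).resolve_right (hsw0 σ)
  have hdiv := fun σ => exists_eq_tBdR_mul_of_thetaBdR_eq_zero (F := F) (p := p) hF (hθzt σ)
  choose z' hz' using hdiv
  -- continuity of `zt` and of `z'`
  have hcorr : ∀ N k : ℕ, ∃ U : OpenSubgroup (absoluteGaloisGroup F), ∀ σ : absoluteGaloisGroup F,
      ∀ τ ∈ U, ∃ (a : Ainf (p := p) F) (w : BDeRhamPlus (integerC F) p),
        ((qpToBdR (((GaloisRep.cyclotomicCharacter F p (σ * τ) : ℤ_[p]ˣ) : ℤ_[p]) : ℚ_[p])) ^ (n + 1) *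
            galBdRPlus (σ * τ) b₀ - b₀) -
          ((qpToBdR (((GaloisRep.cyclotomicCharacter F p σ : ℤ_[p]ˣ) : ℤ_[p]) : ℚ_[p])) ^ (n + 1) *
            galBdRPlus σ b₀ - b₀) = ainfToBdR ((p : Ainf (p := p) F) ^ N * a) + xiBdR ^ k * w := by
    have h := BdRH1Devissage.uc_correction (p := p) (F := F) (((n + 1 : ℕ) : ℤ)) b₀
    simp only [qpToBdR_cyclotomic_zpow_natCast] at h
    exact h
  have hηcorr := GaloisContinuity.uc_sub (uc_embBdRHom_mul hp hF hηcont b₀)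
    (GaloisContinuity.uc_const b₀)
  have hztuc := GaloisContinuity.uc_add (GaloisContinuity.uc_sub hzuc hcorr) hηcorr
  have hz'uc := GaloisContinuity.uc_of_tBdR_mul (F := F) (p := p) hF
    (z := z') (w := fun σ => z σ -
      ((qpToBdR (((GaloisRep.cyclotomicCharacter F p σ : ℤ_[p]ˣ) : ℤ_[p]) : ℚ_[p])) ^ (n + 1) *
          galBdRPlus σ b₀ - b₀) + (embBdRHom hp hF ((η σ : Fˣ) : F) * b₀ - b₀)) hztuc hz'
  refine ⟨b₀, z', hz'uc, fun σ => ?_⟩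
  rw [map_sub, map_mul, galBdRPlus_tBdR_pow, hgal σ, pow_succ _ (n + 1)]
  linear_combination (tBdR ^ (n + 1)) * hz' σ

/-! ## §4 The base case -/

/-- **The base.** Any lift `b₁` of `u` has error cochain `σ(b₁) − η(σ) b₁ ∈ ker θ = t B_dR⁺`, with a
continuous quotient. [cite: FontaineAsterisque223III, Exp. II §1.5.5] -/
theorem base (η : absoluteGaloisGroup F →ₜ* Fˣ) (u : CompletedAlgClosure F)
    (hper : ∀ σ : absoluteGaloisGroup F,
      σ • u = algebraMap F (CompletedAlgClosure F) ((η σ : Fˣ) : F) * u) :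
    ∃ (b : BDeRhamPlus (integerC F) p) (z : absoluteGaloisGroup F → BDeRhamPlus (integerC F) p),
      thetaBdR b = u ∧
      (∀ N k : ℕ, ∃ U : OpenSubgroup (absoluteGaloisGroup F), ∀ σ : absoluteGaloisGroup F, ∀ τ ∈ U,
        ∃ (a : Ainf (p := p) F) (w : BDeRhamPlus (integerC F) p),
          z (σ * τ) - z σ = ainfToBdR ((p : Ainf (p := p) F) ^ N * a) + xiBdR ^ k * w) ∧
      ∀ σ, galBdRPlus σ b - embBdRHom hp hF ((η σ : Fˣ) : F) * b = tBdR ^ (0 + 1) * z σ := by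
  classical
  obtain ⟨b, hb⟩ := thetaBdR_surjective hF u
  have hηcont : Continuous fun σ : absoluteGaloisGroup F => ((η σ : Fˣ) : F) :=
    Units.continuous_val.comp η.continuous
  have hθ : ∀ σ : absoluteGaloisGroup F,
      thetaBdR (galBdRPlus σ b - embBdRHom hp hF ((η σ : Fˣ) : F) * b) = 0 := by
    intro σ
    rw [map_sub, map_mul, thetaBdR_galBdRPlus, thetaBdR_embBdRHom, hb, hper σ, sub_self]
  have hdiv := fun σ => exists_eq_tBdR_mul_of_thetaBdR_eq_zero (F := F) (p := p) hF (hθ σ)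
  choose z hz using hdiv
  have hduc := GaloisContinuity.uc_sub (GaloisContinuity.uc_galBdRPlus b)
    (uc_embBdRHom_mul hp hF hηcont b)
  have hzuc := GaloisContinuity.uc_of_tBdR_mul (F := F) (p := p) hF (z := z)
    (w := fun σ => galBdRPlus σ b - embBdRHom hp hF ((η σ : Fˣ) : F) * b) hduc hz
  exact ⟨b, z, hb, hzuc, fun σ => by rw [zero_add, pow_one]; exact hz σ⟩

/-! ## §5 The limit -/

set_option maxHeartbeats 1600000 in
/-- **Lifting `ℂ_F`-periods to unit periods in `B_dR⁺`.** For a continuous character `η : Γ_F → Fˣ`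
and `u ∈ ℂ_F^×` with `σ(u) = η(σ) u`, there is `b ∈ B_dR⁺` with `θ(b) = u` and `σ(b) = η(σ) b` for all
`σ ∈ Γ_F`. [cite: FontaineAsterisque223III, Exp. II §1.5.5] [cite: Tate1967, §3.3 Theorem 2]
[cite: Sen1980, §1] -/
theorem exists_galBdRPlus_eq_embBdRHom_mul (η : absoluteGaloisGroup F →ₜ* Fˣ)
    (u : CompletedAlgClosure F) (hu : u ≠ 0)
    (hper : ∀ σ : absoluteGaloisGroup F,
      σ • u = algebraMap F (CompletedAlgClosure F) ((η σ : Fˣ) : F) * u) :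
    ∃ b : BDeRhamPlus (integerC F) p, thetaBdR b = u ∧
      ∀ σ : absoluteGaloisGroup F, galBdRPlus σ b = embBdRHom hp hF ((η σ : Fˣ) : F) * b := by
  classical
  -- the invariant at level `n`
  let UC : (absoluteGaloisGroup F → BDeRhamPlus (integerC F) p) → Prop := fun z =>
    ∀ N k : ℕ, ∃ U : OpenSubgroup (absoluteGaloisGroup F), ∀ σ : absoluteGaloisGroup F, ∀ τ ∈ U,
      ∃ (a : Ainf (p := p) F) (w : BDeRhamPlus (integerC F) p),
        z (σ * τ) - z σ = ainfToBdR ((p : Ainf (p := p) F) ^ N * a) + xiBdR ^ k * w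
  let Inv : ℕ → BDeRhamPlus (integerC F) p × (absoluteGaloisGroup F → BDeRhamPlus (integerC F) p) →
      Prop := fun n bz => thetaBdR bz.1 = u ∧ UC bz.2 ∧
    ∀ σ, galBdRPlus σ bz.1 - embBdRHom hp hF ((η σ : Fˣ) : F) * bz.1 = tBdR ^ (n + 1) * bz.2 σ
  have huw : u * u⁻¹ = 1 := mul_inv_cancel₀ hu
  -- base and step, packaged
  have hbase : ∃ bz, Inv 0 bz := by
    obtain ⟨b, z, hb, hzuc, hz⟩ := base hp hF η u hper
    exact ⟨(b, z), hb, hzuc, hz⟩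
  have hstep : ∀ n bz, Inv n bz → ∃ bz', Inv (n + 1) bz' ∧
      ∃ y, bz'.1 = bz.1 - tBdR ^ (n + 1) * y := by
    rintro n ⟨b, z⟩ ⟨hb, hzuc, hz⟩
    obtain ⟨y, z', hz'uc, hz'⟩ := step hp hF η huw hper n b z hzuc hz
    refine ⟨(b - tBdR ^ (n + 1) * y, z'), ⟨?_, hz'uc, hz'⟩, y, rfl⟩
    show thetaBdR (b - tBdR ^ (n + 1) * y) = u
    have hθt : thetaBdR (tBdR : BDeRhamPlus (integerC F) p) = 0 := by
      obtain ⟨v, -, htv⟩ := exists_tBdR_eq_xiBdR_mul (F := F) (p := p) hF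
      rw [htv, map_mul, thetaBdR_xiBdR, zero_mul]
    rw [map_sub, map_mul, map_pow, hθt, zero_pow (Nat.succ_ne_zero n), zero_mul,
      sub_zero, hb]
  -- the sequence
  let seq : (n : ℕ) → {bz // Inv n bz} :=
    Nat.rec ⟨hbase.choose, hbase.choose_spec⟩
      fun n s => ⟨(hstep n s.1 s.2).choose, (hstep n s.1 s.2).choose_spec.1⟩
  have hseq : ∀ n, ∃ y, (seq (n + 1)).1.1 = (seq n).1.1 - tBdR ^ (n + 1) * y := fun n =>
    (hstep n (seq n).1 (seq n).2).choose_spec.2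
  -- Cauchy for the `ξ`-adic topology
  let I : Ideal (BDeRhamPlus (integerC F) p) := Ideal.span {xiBdR}
  haveI : IsAdicComplete I (BDeRhamPlus (integerC F) p) := isAdicComplete_span_xiBdR
  have hmodI : ∀ (m : ℕ) (x : BDeRhamPlus (integerC F) p), x ∈ I ^ m →
      x ∈ (I ^ m • ⊤ : Submodule (BDeRhamPlus (integerC F) p) (BDeRhamPlus (integerC F) p)) := by
    intro m x hx
    rw [smul_eq_mul, Ideal.mul_top]; exact hx
  have hsucc : ∀ n, (seq n).1.1 ≡ (seq (n + 1)).1.1 [SMOD (I ^ (n + 1) •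
      (⊤ : Submodule (BDeRhamPlus (integerC F) p) (BDeRhamPlus (integerC F) p)))] := by
    intro n
    obtain ⟨y, hy⟩ := hseq n
    rw [SModEq.sub_mem, hy, sub_sub_cancel]
    exact hmodI _ _ (tBdR_pow_mul_mem_span_xiBdR_pow hF (n + 1) y)
  have hcauchy : ∀ {m n : ℕ}, m ≤ n → (seq m).1.1 ≡ (seq n).1.1 [SMOD (I ^ m •
      (⊤ : Submodule (BDeRhamPlus (integerC F) p) (BDeRhamPlus (integerC F) p)))] := by
    intro m n hmn
    induction n, hmn using Nat.le_induction with
    | base => exact SModEq.rfl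
    | succ k hmk ih =>
      exact ih.trans ((hsucc k).mono (Submodule.smul_mono_left
        (Ideal.pow_le_pow_right (by omega))))
  obtain ⟨L, hL⟩ := IsPrecomplete.prec (IsAdicComplete.toIsPrecomplete (I := I)) hcauchy
  refine ⟨L, ?_, fun σ => ?_⟩
  · -- `θ(L) = u`: `L ≡ b₁ (mod ξ)`
    have h1 := hL 1
    rw [SModEq.sub_mem, pow_one, smul_eq_mul, Ideal.mul_top] at h1
    have h2 : thetaBdR ((seq 1).1.1 - L) = 0 := (mem_ker_thetaBdR_iff _).2 h1
    rw [map_sub, (seq 1).2.1, sub_eq_zero] at h2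
    exact h2.symm
  · -- equivariance: the defect lies in every `I^n`
    refine sub_eq_zero.1 (IsHausdorff.haus (IsAdicComplete.toIsHausdorff (I := I)) _ fun m => ?_)
    rw [SModEq.sub_mem, sub_zero]
    -- `σ(L) - η L = (σ(L - b_m) - η (L - b_m)) + (σ b_m - η b_m)` with `b_m = seq m`
    have hLm := hL m
    rw [SModEq.sub_mem, smul_eq_mul, Ideal.mul_top] at hLm
    -- `σ` preserves `I^m`
    have hgalI : ∀ x : BDeRhamPlus (integerC F) p, x ∈ I ^ m → galBdRPlus σ x ∈ I ^ m := by
      intro x hx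
      rw [Ideal.span_singleton_pow, Ideal.mem_span_singleton] at hx ⊢
      obtain ⟨c, rfl⟩ := hx
      obtain ⟨d, hd⟩ := GaloisContinuity.exists_galBdRPlus_xiBdR_pow_mul (F := F) (p := p) σ m c
      exact ⟨d, hd⟩
    have hdef : galBdRPlus σ L - embBdRHom hp hF ((η σ : Fˣ) : F) * L =
        -(galBdRPlus σ ((seq m).1.1 - L) - embBdRHom hp hF ((η σ : Fˣ) : F) * ((seq m).1.1 - L)) +
          tBdR ^ (m + 1) * (seq m).1.2 σ := by
      rw [← (seq m).2.2.2 σ, map_sub]; ring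
    rw [hdef]
    refine hmodI _ _ (Ideal.add_mem _ (Submodule.neg_mem _ (Ideal.sub_mem _ (hgalI _ hLm)
      (Ideal.mul_mem_left _ _ hLm))) ?_)
    exact Ideal.pow_le_pow_right (Nat.le_succ m) (tBdR_pow_mul_mem_span_xiBdR_pow hF (m + 1) _)

/-- **Unit form.** The lifted period is a unit of `B_dR⁺`. [cite: FontaineAsterisque223III, Exp. II §1.5.5] -/
theorem exists_isUnit_galBdRPlus_eq_embBdRHom_mul (η : absoluteGaloisGroup F →ₜ* Fˣ)
    (u : CompletedAlgClosure F) (hu : u ≠ 0)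
    (hper : ∀ σ : absoluteGaloisGroup F,
      σ • u = algebraMap F (CompletedAlgClosure F) ((η σ : Fˣ) : F) * u) :
    ∃ b : BDeRhamPlus (integerC F) p, IsUnit b ∧ thetaBdR b = u ∧
      ∀ σ : absoluteGaloisGroup F, galBdRPlus σ b = embBdRHom hp hF ((η σ : Fˣ) : F) * b := by
  obtain ⟨b, hb, hgal⟩ := exists_galBdRPlus_eq_embBdRHom_mul hp hF η u hu hper
  exact ⟨b, (isUnit_iff_thetaBdR_ne_zero hF b).2 (hb ▸ hu), hb, hgal⟩

/-- **Period in `B_dR = Frac B_dR⁺`, stabiliser form.** With `z = b⁻¹ ∈ B_dR`: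
`z = η(σ) · σ(z)` for all `σ ∈ Γ_F`, the shape consumed by
`fontainePst_isDeRhamFramed_of_stabilizerPeriods`. [cite: FontaineAsterisque223III, Exp. II §1.5.5] -/
theorem exists_fracBdR_eq_embBdRHom_mul_smul [IsDomain (BDeRhamPlus (integerC F) p)]
    (η : absoluteGaloisGroup F →ₜ* Fˣ) (u : CompletedAlgClosure F) (hu : u ≠ 0)
    (hper : ∀ σ : absoluteGaloisGroup F,
      σ • u = algebraMap F (CompletedAlgClosure F) ((η σ : Fˣ) : F) * u) :
    ∃ z : FracBdR F p, z ≠ 0 ∧ ∀ σ : absoluteGaloisGroup F,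
      z = algebraMap (BDeRhamPlus (integerC F) p) (FracBdR F p) (embBdRHom hp hF ((η σ : Fˣ) : F)) *
        σ • z := by
  obtain ⟨b, hbU, -, hgal⟩ := exists_isUnit_galBdRPlus_eq_embBdRHom_mul hp hF η u hu hper
  have hb0 : algebraMap (BDeRhamPlus (integerC F) p) (FracBdR F p) b ≠ 0 :=
    (map_ne_zero_iff _ (algebraMap_fracBdR_injective (F := F) (p := p))).2 hbU.ne_zero
  refine ⟨(algebraMap (BDeRhamPlus (integerC F) p) (FracBdR F p) b)⁻¹, inv_ne_zero hb0, fun σ => ?_⟩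
  rw [smul_inv'', smul_algebraMap_fracBdR, hgal σ, map_mul, mul_inv, ← mul_assoc]
  have hη0 : algebraMap (BDeRhamPlus (integerC F) p) (FracBdR F p)
      (embBdRHom hp hF ((η σ : Fˣ) : F)) ≠ 0 :=
    (map_ne_zero_iff _ (algebraMap_fracBdR_injective (F := F) (p := p))).2
      ((map_ne_zero (embBdRHom hp hF)).2 (Units.ne_zero _))
  rw [mul_inv_cancel₀ hη0, one_mul]

end BdRUnitPeriodLift

end Literature.NumberTheory.PAdicHodge

end
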